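import Literature.AlgebraicGeometry.Motives.AbelianVarietyEquivariantHomCharacterBound
import HarnessLib

/-!
# Invariant homomorphisms out of (or into) an abelian variety with a finite group action:
# `rk_{ℤ_ℓ} Hom_{ℤ_ℓ}(T_ℓ X, T_ℓ Y)^G = 4 · dim B_G · dim Y` and `rk_ℤ Hom(X, Y)^G ≤ 4 · dim B_G · dim Y`

Let `ρ : G → End X` be an action of a finite group on an abelian variety `X` over a field `K`, `N_G = Σ_g ρ(g)` its norm
endomorphism and `B_G = Im N_G ⊆ X` the Kani–Rosen factor of the trivial representation (isogenous to the quotient `X/G`),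
and let `Y` be any abelian variety (trivial action).  Specialising the `ℓ`-adic inner-product formula and the rank bound of
`Motives/AbelianVarietyEquivariantHomCharacterBound` (`|G| · rk Hom_{ℤ_ℓ[G]}(T_ℓ X, T_ℓ Y) = Σ_g χ_Y(g) χ_X(g⁻¹)`,
`rk_ℤ Hom_G(X, Y) ≤ rk_{ℤ_ℓ} Hom_{ℤ_ℓ[G]}(T_ℓ X, T_ℓ Y)`) to `ρ_Y = 1` (resp. `ρ_X = 1`), where `χ_Y ≡ 2 dim Y` and
`Σ_g χ_X(g) = |G| · 2 dim B_G` (the tree's `card_mul_two_mul_dim_image_normG_eq_sum_trace_tateModuleMap`), gives for a prime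
`ℓ` invertible in `K`:

* **source-invariant maps** `Hom_{ℤ_ℓ}(T_ℓ X, T_ℓ Y)^G = {f | f ∘ T_ℓ ρ(g) = f ∀ g}`:
  `|G| · rk = 2 dim Y · Σ_g χ_ℓ(g)` (`card_mul_finrank_tateHom_source_invariant_eq`), hence
  **`rk_{ℤ_ℓ} {f : T_ℓ X → T_ℓ Y | f ∘ T_ℓ ρ(g) = f} = 4 · dim B_G · dim Y`** (`finrank_tateHom_source_invariant_eq`) and
  **`rk_ℤ {f : X → Y | ρ(g) ≫ f = f ∀ g} ≤ 4 · dim B_G · dim Y`** (`finrank_hom_source_invariant_le_four_mul`) — the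
  `G`-invariant refinement of Mumford's `rk Hom(X, Y) ≤ 4 dim X dim Y` (§19 Cor. 1), "homomorphisms constant on `G`-orbits
  are as numerous as homomorphisms out of `X/G ∼ B_G`";
* **target-invariant maps** (`ρ' : G → End Y`, `B'_G = Im N'_G ⊆ Y`, `X` arbitrary):
  `|G| · rk {f | T_ℓ ρ'(g) ∘ f = f} = 2 dim X · Σ_g χ'_ℓ(g)`, **`rk_{ℤ_ℓ} = 4 · dim X · dim B'_G`**,
  **`rk_ℤ {f : X → Y | f ≫ ρ'(g) = f ∀ g} ≤ 4 · dim X · dim B'_G`**.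

## Main statements (sorry-free; theorems only, no new definitions)

* `tateModuleMap_asHom_one_hom` (`T_ℓ` of the trivial action is `id`), `sum_trace_tateModuleMap_asHom_inv_eq_sum`
  (`Σ_g χ(g⁻¹) = Σ_g χ(g)`), membership / identification lemmas `mem_iInf_eqLocus_llcomp_lcomp_iff`,
  `mem_iInf_eqLocus_lcomp_id_iff`, `mem_iInf_eqLocus_llcomp_id_iff`, `iInf_eqLocus_llcomp_one_lcomp_eq`,
  `iInf_eqLocus_llcomp_lcomp_one_eq`, `mem_iInf_eqLocus_leftComp_id_iff`, `mem_iInf_eqLocus_rightComp_id_iff`,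
  `iInf_eqLocus_leftComp_rightComp_one_eq`, `iInf_eqLocus_leftComp_one_rightComp_eq`;
* source: **`card_mul_finrank_tateHom_source_invariant_eq`**, **`finrank_tateHom_source_invariant_eq`**,
  `finrank_hom_source_invariant_le`, **`finrank_hom_source_invariant_le_four_mul`**;
* target: **`card_mul_finrank_tateHom_target_invariant_eq`**, **`finrank_tateHom_target_invariant_eq`**,
  `finrank_hom_target_invariant_le`, **`finrank_hom_target_invariant_le_four_mul`**.

Scope (stated, not hidden).  `ℓ` invertible in `K`; `B_G` enters only through an endomorphism `N_G` with `N_G = Σ_g ρ(g)`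
(`End.of NG = Σ_g ρ g`); the Hom-side statements are inequalities (no Tate conjecture is used); submodules are written as
`⨅_g eqLocus` of Mathlib's `LinearMap.lcomp/llcomp` and `Preadditive.leftComp/rightComp`.

## References

* [MumfordAV1970] D. Mumford, *Abelian Varieties* (1970), §19 Thm. 3 and Cor. 1 (pp. 176–178), Thm. 4 (p. 180).
* [Milne1986AbelianVarieties] J. S. Milne, *Abelian varieties*, in Cornell–Silverman (1986), Lemma 12.2, Thm. 12.5 (pp. 189–190).
* [SerreLinearRepresentations1977] J.-P. Serre, *Linear Representations of Finite Groups*, §2.3 (`⟨χ, 1⟩ = dim V^G`,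
  `dim Hom_G(V, W) = ⟨χ_V, χ_W⟩`).
* [KaniRosen1989] E. Kani, M. Rosen, *Idempotent relations and factors of Jacobians*, Math. Ann. 284 (1989), §3 (Thm. B).
* [LangeRodriguez2022] H. Lange, R. E. Rodríguez, *Decomposition of Jacobians by Prym Varieties*, LNM 2310 (2022), §2.9.1
  Prop. 2.9.3, Cor. 3.5.10 (PDF pp. 46, 93).
* [DokchitserEtAl2022] V. Dokchitser, H. Green, A. Konstantinou, A. Morgan, *Parity of ranks of Jacobians of curves*,
  arXiv:2211.06357, §3 (additive functor lemma, `F = V_ℓ`: `V_ℓ(B_H) ≅ V_ℓ(X)^H`).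
-/

noncomputable section

open CategoryTheory CategoryTheory.Limits
open Literature.RepresentationTheory.FiniteGroups
open Literature.NumberTheory.DiophantineGeometry

universe u

namespace Literature.AlgebraicGeometry.Motives

namespace AbelianVariety

variable {K : Type u} [Field K] (ℓ : ℕ) [Fact ℓ.Prime] {X Y : AbelianVariety K} {G : Type} [Group G]

/-! ## §1 Helpers: the trivial action, inversion in character sums, membership lemmas -/

section Helpers

variable (ρX : G →* End X) (ρY : G →* End Y)

/-- `T_ℓ` of the trivial action is the identity: `T_ℓ((1 : G → End Y)(g)) = id` (functoriality of `T_ℓ`).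
[cite: MumfordAV1970, §19 Thm. 3 (p. 176: `T_ℓ` is a functor)] -/
theorem tateModuleMap_asHom_one_hom (g : G) :
    tateModuleMap ℓ (End.asHom ((1 : G →* End Y) g)) = LinearMap.id := by
  rw [MonoidHom.one_apply, show End.asHom (1 : End Y) = 𝟙 Y from rfl, tateModuleMap_id]

/-- `Σ_g χ_ℓ(g⁻¹) = Σ_g χ_ℓ(g)` (reindex by inversion). [cite: SerreLinearRepresentations1977, §2.3] -/
theorem sum_trace_tateModuleMap_asHom_inv_eq_sum [Fintype G] :
    ∑ g, LinearMap.trace ℤ_[ℓ] (X.tateModule ℓ) (tateModuleMap ℓ (End.asHom (ρX g⁻¹))) =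
      ∑ g, LinearMap.trace ℤ_[ℓ] (X.tateModule ℓ) (tateModuleMap ℓ (End.asHom (ρX g))) :=
  Fintype.sum_equiv (Equiv.inv G) _ _ fun _ ↦ rfl

/-- Membership in the equivariant maps `Hom_{ℤ_ℓ[G]}(T_ℓ X, T_ℓ Y) = ⋂_g {f | T_ℓ ρ_Y(g) ∘ f = f ∘ T_ℓ ρ_X(g)}`.
[cite: SerreLinearRepresentations1977, §2.3] -/
theorem mem_iInf_eqLocus_llcomp_lcomp_iff (f : X.tateModule ℓ →ₗ[ℤ_[ℓ]] Y.tateModule ℓ) :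
    f ∈ (⨅ g : G, LinearMap.eqLocus (LinearMap.llcomp ℤ_[ℓ] _ _ _ (tateModuleMap ℓ (End.asHom (ρY g))))
        (LinearMap.lcomp ℤ_[ℓ] _ (tateModuleMap ℓ (End.asHom (ρX g)))) :
          Submodule ℤ_[ℓ] (X.tateModule ℓ →ₗ[ℤ_[ℓ]] Y.tateModule ℓ)) ↔
      ∀ g, tateModuleMap ℓ (End.asHom (ρY g)) ∘ₗ f = f ∘ₗ tateModuleMap ℓ (End.asHom (ρX g)) := by
  simp only [Submodule.mem_iInf, LinearMap.mem_eqLocus, LinearMap.llcomp_apply', LinearMap.lcomp_apply']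

/-- Membership in the source-invariant maps `{f | f ∘ T_ℓ ρ(g) = f ∀ g}`. [cite: SerreLinearRepresentations1977, §2.3] -/
theorem mem_iInf_eqLocus_lcomp_id_iff (f : X.tateModule ℓ →ₗ[ℤ_[ℓ]] Y.tateModule ℓ) :
    f ∈ (⨅ g : G, LinearMap.eqLocus (LinearMap.lcomp ℤ_[ℓ] (Y.tateModule ℓ) (tateModuleMap ℓ (End.asHom (ρX g))))
        LinearMap.id : Submodule ℤ_[ℓ] (X.tateModule ℓ →ₗ[ℤ_[ℓ]] Y.tateModule ℓ)) ↔
      ∀ g, f ∘ₗ tateModuleMap ℓ (End.asHom (ρX g)) = f := by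
  simp only [Submodule.mem_iInf, LinearMap.mem_eqLocus, LinearMap.lcomp_apply', LinearMap.id_apply]

/-- Membership in the target-invariant maps `{f | T_ℓ ρ'(g) ∘ f = f ∀ g}`. [cite: SerreLinearRepresentations1977, §2.3] -/
theorem mem_iInf_eqLocus_llcomp_id_iff (f : X.tateModule ℓ →ₗ[ℤ_[ℓ]] Y.tateModule ℓ) :
    f ∈ (⨅ g : G, LinearMap.eqLocus (LinearMap.llcomp ℤ_[ℓ] (X.tateModule ℓ) _ _ (tateModuleMap ℓ (End.asHom (ρY g))))
        LinearMap.id : Submodule ℤ_[ℓ] (X.tateModule ℓ →ₗ[ℤ_[ℓ]] Y.tateModule ℓ)) ↔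
      ∀ g, tateModuleMap ℓ (End.asHom (ρY g)) ∘ₗ f = f := by
  simp only [Submodule.mem_iInf, LinearMap.mem_eqLocus, LinearMap.llcomp_apply', LinearMap.id_apply]

/-- For the trivial action on `Y`, the equivariant maps are the source-invariant maps:
`Hom_{ℤ_ℓ[G]}(T_ℓ X, T_ℓ Y_{triv}) = {f | f ∘ T_ℓ ρ(g) = f}`. [cite: SerreLinearRepresentations1977, §2.3] -/
theorem iInf_eqLocus_llcomp_one_lcomp_eq :
    (⨅ g : G, LinearMap.eqLocus (LinearMap.llcomp ℤ_[ℓ] _ _ _ (tateModuleMap ℓ (End.asHom ((1 : G →* End Y) g))))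
        (LinearMap.lcomp ℤ_[ℓ] _ (tateModuleMap ℓ (End.asHom (ρX g)))) :
          Submodule ℤ_[ℓ] (X.tateModule ℓ →ₗ[ℤ_[ℓ]] Y.tateModule ℓ)) =
      ⨅ g : G, LinearMap.eqLocus (LinearMap.lcomp ℤ_[ℓ] (Y.tateModule ℓ) (tateModuleMap ℓ (End.asHom (ρX g))))
        LinearMap.id := by
  refine Submodule.ext fun f ↦ ?_
  rw [mem_iInf_eqLocus_llcomp_lcomp_iff, mem_iInf_eqLocus_lcomp_id_iff]
  refine forall_congr' fun g ↦ ?_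
  rw [tateModuleMap_asHom_one_hom, LinearMap.id_comp, eq_comm]

/-- For the trivial action on `X`, the equivariant maps are the target-invariant maps:
`Hom_{ℤ_ℓ[G]}(T_ℓ X_{triv}, T_ℓ Y) = {f | T_ℓ ρ'(g) ∘ f = f}`. [cite: SerreLinearRepresentations1977, §2.3] -/
theorem iInf_eqLocus_llcomp_lcomp_one_eq :
    (⨅ g : G, LinearMap.eqLocus (LinearMap.llcomp ℤ_[ℓ] _ _ _ (tateModuleMap ℓ (End.asHom (ρY g))))
        (LinearMap.lcomp ℤ_[ℓ] _ (tateModuleMap ℓ (End.asHom ((1 : G →* End X) g)))) :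
          Submodule ℤ_[ℓ] (X.tateModule ℓ →ₗ[ℤ_[ℓ]] Y.tateModule ℓ)) =
      ⨅ g : G, LinearMap.eqLocus (LinearMap.llcomp ℤ_[ℓ] (X.tateModule ℓ) _ _ (tateModuleMap ℓ (End.asHom (ρY g))))
        LinearMap.id := by
  refine Submodule.ext fun f ↦ ?_
  rw [mem_iInf_eqLocus_llcomp_lcomp_iff, mem_iInf_eqLocus_llcomp_id_iff]
  refine forall_congr' fun g ↦ ?_
  rw [tateModuleMap_asHom_one_hom, LinearMap.comp_id]

omit [Fact ℓ.Prime] in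
/-- Membership in `Hom(X, Y)^G = {f | ρ(g) ≫ f = f ∀ g}` (source-invariant homomorphisms). [cite: SerreLinearRepresentations1977, §2.3] -/
theorem mem_iInf_eqLocus_leftComp_id_iff (f : X ⟶ Y) :
    f ∈ (⨅ g : G, LinearMap.eqLocus (Preadditive.leftComp Y (End.asHom (ρX g))).toIntLinearMap LinearMap.id :
        Submodule ℤ (X ⟶ Y)) ↔
      ∀ g, End.asHom (ρX g) ≫ f = f := by
  simp only [Submodule.mem_iInf, LinearMap.mem_eqLocus]
  exact Iff.rfl

omit [Fact ℓ.Prime] in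
/-- Membership in `{f | f ≫ ρ'(g) = f ∀ g}` (target-invariant homomorphisms). [cite: SerreLinearRepresentations1977, §2.3] -/
theorem mem_iInf_eqLocus_rightComp_id_iff (f : X ⟶ Y) :
    f ∈ (⨅ g : G, LinearMap.eqLocus (Preadditive.rightComp X (End.asHom (ρY g))).toIntLinearMap LinearMap.id :
        Submodule ℤ (X ⟶ Y)) ↔
      ∀ g, f ≫ End.asHom (ρY g) = f := by
  simp only [Submodule.mem_iInf, LinearMap.mem_eqLocus]
  exact Iff.rfl

omit [Fact ℓ.Prime] in
/-- For the trivial action on `Y`, `Hom_G(X, Y_{triv}) = Hom(X, Y)^G = {f | ρ(g) ≫ f = f}`. [cite: SerreLinearRepresentations1977, §2.3] -/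
theorem iInf_eqLocus_leftComp_rightComp_one_eq :
    (⨅ g : G, LinearMap.eqLocus (Preadditive.leftComp Y (End.asHom (ρX g))).toIntLinearMap
        (Preadditive.rightComp X (End.asHom ((1 : G →* End Y) g))).toIntLinearMap : Submodule ℤ (X ⟶ Y)) =
      ⨅ g : G, LinearMap.eqLocus (Preadditive.leftComp Y (End.asHom (ρX g))).toIntLinearMap LinearMap.id := by
  refine Submodule.ext fun f ↦ ?_
  rw [mem_iInf_eqLocus_leftComp_rightComp_iff, mem_iInf_eqLocus_leftComp_id_iff]
  refine forall_congr' fun g ↦ ?_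
  rw [MonoidHom.one_apply, show End.asHom (1 : End Y) = 𝟙 Y from rfl, Category.comp_id]

omit [Fact ℓ.Prime] in
/-- For the trivial action on `X`, `Hom_G(X_{triv}, Y) = {f | f ≫ ρ'(g) = f}`. [cite: SerreLinearRepresentations1977, §2.3] -/
theorem iInf_eqLocus_leftComp_one_rightComp_eq :
    (⨅ g : G, LinearMap.eqLocus (Preadditive.leftComp Y (End.asHom ((1 : G →* End X) g))).toIntLinearMap
        (Preadditive.rightComp X (End.asHom (ρY g))).toIntLinearMap : Submodule ℤ (X ⟶ Y)) =
      ⨅ g : G, LinearMap.eqLocus (Preadditive.rightComp X (End.asHom (ρY g))).toIntLinearMap LinearMap.id := by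
  refine Submodule.ext fun f ↦ ?_
  rw [mem_iInf_eqLocus_leftComp_rightComp_iff, mem_iInf_eqLocus_rightComp_id_iff]
  refine forall_congr' fun g ↦ ?_
  rw [MonoidHom.one_apply, show End.asHom (1 : End X) = 𝟙 X from rfl, Category.id_comp, eq_comm]

end Helpers

/-! ## §2 Source-invariant maps: `rk {f | f ∘ T_ℓ ρ(g) = f} = 4 dim B_G dim Y`, `rk {f : X → Y | ρ(g) ≫ f = f} ≤ 4 dim B_G dim Y` -/

section Source

variable (ρ : G →* End X)

/-- **`|G| · rk_{ℤ_ℓ} {f : T_ℓ X → T_ℓ Y | f ∘ T_ℓ ρ(g) = f ∀ g} = 2 dim Y · Σ_{g ∈ G} χ_ℓ(g)`** (`ℓ` invertible in `K`):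
the `ℓ`-adic inner product with the trivial action on `Y`, `χ_Y ≡ 2 dim Y`. [cite: SerreLinearRepresentations1977, §2.3]
[cite: MumfordAV1970, §19 Thm. 3 (p. 176), Thm. 4 (p. 180)] -/
theorem card_mul_finrank_tateHom_source_invariant_eq [Fintype G] (hℓ : (ℓ : K) ≠ 0) :
    (Fintype.card G : ℤ_[ℓ]) * Module.finrank ℤ_[ℓ]
        (⨅ g : G, LinearMap.eqLocus (LinearMap.lcomp ℤ_[ℓ] (Y.tateModule ℓ) (tateModuleMap ℓ (End.asHom (ρ g))))
          LinearMap.id : Submodule ℤ_[ℓ] (X.tateModule ℓ →ₗ[ℤ_[ℓ]] Y.tateModule ℓ)) =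
      2 * Y.dim * ∑ g, LinearMap.trace ℤ_[ℓ] (X.tateModule ℓ) (tateModuleMap ℓ (End.asHom (ρ g))) := by
  haveI := Y.module_free_tateModule_holds ℓ hℓ
  haveI := module_finite_tateModule_of_cast_ne_zero Y ℓ hℓ
  rw [← iInf_eqLocus_llcomp_one_lcomp_eq ℓ ρ, card_mul_finrank_equivariantTateHom_eq_sum ℓ ρ (1 : G →* End Y) hℓ]
  simp_rw [tateModuleMap_asHom_one_hom, LinearMap.trace_id, Y.finrank_tateModule_eq_two_mul_dim ℓ hℓ]
  rw [← Finset.mul_sum, sum_trace_tateModuleMap_asHom_inv_eq_sum, Nat.cast_mul, Nat.cast_ofNat]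

/-- **`rk_{ℤ_ℓ} {f : T_ℓ X → T_ℓ Y | f ∘ T_ℓ ρ(g) = f ∀ g} = 4 · dim B_G · dim Y`** for `N_G = Σ_g ρ(g)`, `B_G = Im N_G` and
`ℓ` invertible in `K` (`Σ_g χ_ℓ(g) = |G| · 2 dim B_G`, and `|G| ≠ 0` in `ℤ_ℓ`): maps killing the augmentation are maps out of
`T_ℓ(X)_G`, of rank `rk (T_ℓ X)^G · rk T_ℓ Y = 2 dim B_G · 2 dim Y`. [cite: DokchitserEtAl2022, §3 (additive functor lemma, `F = V_ℓ`)]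
[cite: KaniRosen1989, Thm. B] [cite: SerreLinearRepresentations1977, §2.3] -/
theorem finrank_tateHom_source_invariant_eq [Fintype G] {NG : X ⟶ X} (hNG : End.of NG = ∑ g, ρ g) (hℓ : (ℓ : K) ≠ 0) :
    Module.finrank ℤ_[ℓ]
        (⨅ g : G, LinearMap.eqLocus (LinearMap.lcomp ℤ_[ℓ] (Y.tateModule ℓ) (tateModuleMap ℓ (End.asHom (ρ g))))
          LinearMap.id : Submodule ℤ_[ℓ] (X.tateModule ℓ →ₗ[ℤ_[ℓ]] Y.tateModule ℓ)) =
      4 * (image NG).dim * Y.dim := by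
  have h := card_mul_finrank_tateHom_source_invariant_eq ℓ (Y := Y) ρ hℓ
  rw [← card_mul_two_mul_dim_image_normG_eq_sum_trace_tateModuleMap ℓ ρ hNG hℓ] at h
  refine Nat.eq_of_mul_eq_mul_left (Fintype.card_pos (α := G)) (Nat.cast_injective (R := ℤ_[ℓ]) ?_)
  push_cast at h ⊢
  rw [h]
  ring

/-- **`rk_ℤ {f : X → Y | ρ(g) ≫ f = f ∀ g} ≤ rk_{ℤ_ℓ} {f : T_ℓ X → T_ℓ Y | f ∘ T_ℓ ρ(g) = f ∀ g}`** (`ℓ` invertible in `K`;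
Mumford §19 Thm. 3 restricted to the invariants, `finrank_equivariantHom_le` with the trivial action on `Y`).
[cite: MumfordAV1970, §19 Thm. 3 (pp. 176–178)] [cite: Milne1986AbelianVarieties, Lemma 12.2, Thm. 12.5 (pp. 189–190)] -/
theorem finrank_hom_source_invariant_le (hℓ : (ℓ : K) ≠ 0) :
    Module.finrank ℤ (⨅ g : G, LinearMap.eqLocus (Preadditive.leftComp Y (End.asHom (ρ g))).toIntLinearMap LinearMap.id :
        Submodule ℤ (X ⟶ Y)) ≤
      Module.finrank ℤ_[ℓ]
        (⨅ g : G, LinearMap.eqLocus (LinearMap.lcomp ℤ_[ℓ] (Y.tateModule ℓ) (tateModuleMap ℓ (End.asHom (ρ g))))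
          LinearMap.id : Submodule ℤ_[ℓ] (X.tateModule ℓ →ₗ[ℤ_[ℓ]] Y.tateModule ℓ)) := by
  rw [← iInf_eqLocus_leftComp_rightComp_one_eq ρ, ← iInf_eqLocus_llcomp_one_lcomp_eq ℓ ρ]
  exact finrank_equivariantHom_le ℓ ρ (1 : G →* End Y) hℓ

/-- **`rk_ℤ {f : X → Y | ρ(g) ≫ f = f ∀ g} ≤ 4 · dim B_G · dim Y`** for a finite group acting on `X` by `ρ`, `N_G = Σ_g ρ(g)`,
`B_G = Im N_G`, any abelian variety `Y` and any prime `ℓ` invertible in `K` used as auxiliary: the `G`-invariant refinement of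
Mumford's `rk Hom(X, Y) ≤ 4 dim X dim Y`. [cite: MumfordAV1970, §19 Thm. 3 and Cor. 1 (pp. 176–178)] [cite: KaniRosen1989, Thm. B]
[cite: LangeRodriguez2022, §2.9.1 Prop. 2.9.3 (PDF p. 46)] -/
theorem finrank_hom_source_invariant_le_four_mul [Fintype G] {NG : X ⟶ X} (hNG : End.of NG = ∑ g, ρ g) (hℓ : (ℓ : K) ≠ 0) :
    Module.finrank ℤ (⨅ g : G, LinearMap.eqLocus (Preadditive.leftComp Y (End.asHom (ρ g))).toIntLinearMap LinearMap.id :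
        Submodule ℤ (X ⟶ Y)) ≤
      4 * (image NG).dim * Y.dim :=
  (finrank_hom_source_invariant_le ℓ ρ hℓ).trans_eq (finrank_tateHom_source_invariant_eq ℓ ρ hNG hℓ)

end Source

/-! ## §3 Target-invariant maps: `rk {f | T_ℓ ρ'(g) ∘ f = f} = 4 dim X dim B'_G`, `rk {f : X → Y | f ≫ ρ'(g) = f} ≤ 4 dim X dim B'_G` -/

section Target

variable (ρ' : G →* End Y)

/-- **`|G| · rk_{ℤ_ℓ} {f : T_ℓ X → T_ℓ Y | T_ℓ ρ'(g) ∘ f = f ∀ g} = 2 dim X · Σ_{g ∈ G} χ'_ℓ(g)`** (`ℓ` invertible in `K`):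
the `ℓ`-adic inner product with the trivial action on `X`, `χ_X ≡ 2 dim X`. [cite: SerreLinearRepresentations1977, §2.3]
[cite: MumfordAV1970, §19 Thm. 3 (p. 176), Thm. 4 (p. 180)] -/
theorem card_mul_finrank_tateHom_target_invariant_eq [Fintype G] (hℓ : (ℓ : K) ≠ 0) :
    (Fintype.card G : ℤ_[ℓ]) * Module.finrank ℤ_[ℓ]
        (⨅ g : G, LinearMap.eqLocus (LinearMap.llcomp ℤ_[ℓ] (X.tateModule ℓ) _ _ (tateModuleMap ℓ (End.asHom (ρ' g))))
          LinearMap.id : Submodule ℤ_[ℓ] (X.tateModule ℓ →ₗ[ℤ_[ℓ]] Y.tateModule ℓ)) =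
      2 * X.dim * ∑ g, LinearMap.trace ℤ_[ℓ] (Y.tateModule ℓ) (tateModuleMap ℓ (End.asHom (ρ' g))) := by
  haveI := X.module_free_tateModule_holds ℓ hℓ
  haveI := module_finite_tateModule_of_cast_ne_zero X ℓ hℓ
  rw [← iInf_eqLocus_llcomp_lcomp_one_eq ℓ ρ', card_mul_finrank_equivariantTateHom_eq_sum ℓ (1 : G →* End X) ρ' hℓ]
  simp_rw [tateModuleMap_asHom_one_hom, LinearMap.trace_id, X.finrank_tateModule_eq_two_mul_dim ℓ hℓ]
  rw [← Finset.sum_mul, Nat.cast_mul, Nat.cast_ofNat, mul_comm]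

/-- **`rk_{ℤ_ℓ} {f : T_ℓ X → T_ℓ Y | T_ℓ ρ'(g) ∘ f = f ∀ g} = 4 · dim X · dim B'_G`** for `N'_G = Σ_g ρ'(g)`, `B'_G = Im N'_G ⊆ Y`
and `ℓ` invertible in `K`: maps into the invariants `(T_ℓ Y)^G`, of rank `2 dim X · 2 dim B'_G`.
[cite: DokchitserEtAl2022, §3 (additive functor lemma, `F = V_ℓ`)] [cite: KaniRosen1989, Thm. B] [cite: SerreLinearRepresentations1977, §2.3] -/
theorem finrank_tateHom_target_invariant_eq [Fintype G] {NG : Y ⟶ Y} (hNG : End.of NG = ∑ g, ρ' g) (hℓ : (ℓ : K) ≠ 0) :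
    Module.finrank ℤ_[ℓ]
        (⨅ g : G, LinearMap.eqLocus (LinearMap.llcomp ℤ_[ℓ] (X.tateModule ℓ) _ _ (tateModuleMap ℓ (End.asHom (ρ' g))))
          LinearMap.id : Submodule ℤ_[ℓ] (X.tateModule ℓ →ₗ[ℤ_[ℓ]] Y.tateModule ℓ)) =
      4 * X.dim * (image NG).dim := by
  have h := card_mul_finrank_tateHom_target_invariant_eq ℓ (X := X) ρ' hℓ
  rw [← card_mul_two_mul_dim_image_normG_eq_sum_trace_tateModuleMap ℓ ρ' hNG hℓ] at h
  refine Nat.eq_of_mul_eq_mul_left (Fintype.card_pos (α := G)) (Nat.cast_injective (R := ℤ_[ℓ]) ?_)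
  push_cast at h ⊢
  rw [h]
  ring

/-- **`rk_ℤ {f : X → Y | f ≫ ρ'(g) = f ∀ g} ≤ rk_{ℤ_ℓ} {f : T_ℓ X → T_ℓ Y | T_ℓ ρ'(g) ∘ f = f ∀ g}`** (`ℓ` invertible in `K`;
`finrank_equivariantHom_le` with the trivial action on `X`). [cite: MumfordAV1970, §19 Thm. 3 (pp. 176–178)]
[cite: Milne1986AbelianVarieties, Lemma 12.2, Thm. 12.5 (pp. 189–190)] -/
theorem finrank_hom_target_invariant_le (hℓ : (ℓ : K) ≠ 0) :
    Module.finrank ℤ (⨅ g : G, LinearMap.eqLocus (Preadditive.rightComp X (End.asHom (ρ' g))).toIntLinearMap LinearMap.id :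
        Submodule ℤ (X ⟶ Y)) ≤
      Module.finrank ℤ_[ℓ]
        (⨅ g : G, LinearMap.eqLocus (LinearMap.llcomp ℤ_[ℓ] (X.tateModule ℓ) _ _ (tateModuleMap ℓ (End.asHom (ρ' g))))
          LinearMap.id : Submodule ℤ_[ℓ] (X.tateModule ℓ →ₗ[ℤ_[ℓ]] Y.tateModule ℓ)) := by
  rw [← iInf_eqLocus_leftComp_one_rightComp_eq ρ', ← iInf_eqLocus_llcomp_lcomp_one_eq ℓ ρ']
  exact finrank_equivariantHom_le ℓ (1 : G →* End X) ρ' hℓ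

/-- **`rk_ℤ {f : X → Y | f ≫ ρ'(g) = f ∀ g} ≤ 4 · dim X · dim B'_G`** for a finite group acting on `Y` by `ρ'`,
`N'_G = Σ_g ρ'(g)`, `B'_G = Im N'_G`, any `X`, any auxiliary prime `ℓ` invertible in `K`.
[cite: MumfordAV1970, §19 Thm. 3 and Cor. 1 (pp. 176–178)] [cite: KaniRosen1989, Thm. B] [cite: LangeRodriguez2022, §2.9.1 Prop. 2.9.3 (PDF p. 46)] -/
theorem finrank_hom_target_invariant_le_four_mul [Fintype G] {NG : Y ⟶ Y} (hNG : End.of NG = ∑ g, ρ' g)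
    (hℓ : (ℓ : K) ≠ 0) :
    Module.finrank ℤ (⨅ g : G, LinearMap.eqLocus (Preadditive.rightComp X (End.asHom (ρ' g))).toIntLinearMap LinearMap.id :
        Submodule ℤ (X ⟶ Y)) ≤
      4 * X.dim * (image NG).dim :=
  (finrank_hom_target_invariant_le ℓ ρ' hℓ).trans_eq (finrank_tateHom_target_invariant_eq ℓ ρ' hNG hℓ)

end Target

end AbelianVariety

end Literature.AlgebraicGeometry.Motives
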